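/-
Literature anchor (engines group, cap lane, anchor #33): computable sparse multivariate
polynomials with rational coefficients — their semantics in `MvPolynomial (Fin n) R`, exact
arithmetic (sum, scalar multiple, product, merging of like terms, partial derivatives) and
Moore's natural interval extension over boxes with rational endpoints, all reducible in the
kernel; the data layer of a kernel-checkable high-order enclosure certificate
(`Literature/Analysis/ODE/HighOrderEnclosureCertificate.lean`).
-/
import Mathlib.Algebra.MvPolynomial.PDeriv
import Mathlib.Algebra.BigOperators.Fin
import Mathlib.Data.Rat.Cast.CharZero
import Mathlib.Data.Rat.Cast.Order
import Literature.Analysis.ValidatedNumerics.IntervalEnclosure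
import HarnessLib

/-!
# Sparse rational polynomials: exact arithmetic and natural interval extension

Trunk T-ANA (Analysis/ValidatedNumerics); namespace `Literature.Analysis.ValidatedNumerics`,
sub-namespace `QMvPoly`.

Moore's interval methods for initial value problems (*Methods and Applications of Interval
Analysis*, SIAM 1979, §3.4 and §8.1) manipulate the Taylor coefficients of the solution of
`y' = p(y)` as *polynomials in the initial data*, generated recursively by arithmetic on
polynomials (§3.4 (3.13)–(3.18); §8.1 (8.9)), and then *evaluate* them in interval arithmetic
over boxes (§3.3 Theorem 3.1 / Corollary 3.1: a rational interval function which is an interval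
extension of `f` contains the range of `f`; §8.1 (8.10)).  When the coefficients of `p` and the
box endpoints are rational, every one of these operations is exact rational arithmetic, so the
whole computation can be *replayed by the Lean kernel* (`decide`).  Mathlib's
`MvPolynomial σ R` is a classical `Finsupp` and does not compute; this file supplies the
computable mirror and ties it to `MvPolynomial (Fin n) R` once and for all.

## Contents

* `QMvPoly` — a polynomial in the variables `x₀, …, x_{n-1}` (for any `n`) as a list of terms
  `(m, c)`: exponent list `m : List ℕ` (entry `i` = exponent of `xᵢ`, missing entries = `0`) and
  coefficient `c : ℚ`; duplicate exponent lists are allowed (they add up).  Semantics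
  `QMvPoly.toMv R n q : MvPolynomial (Fin n) R` in any field of characteristic zero
  (`QMvPoly.mexp n m : Fin n →₀ ℕ` is the exponent of a term), `QMvPoly.eval_toMv_cons` /
  `QMvPoly.eval_monomial_mexp` (evaluation = `∑ c · ∏ xᵢ^{mᵢ}`).
* exact arithmetic with its semantics: `append` = sum (`toMv_append`), `smul` (`toMv_smul`),
  `mulMono` / `mul` (`toMv_mul`, via `MvPolynomial.monomial_mul`), `ins` / `normalize`
  (merging of like terms, `toMv_normalize`), `pderivQ` (`toMv_pderivQ`: the formal partial
  derivative, via `MvPolynomial.pderiv_monomial`), `var` (`toMv_var = X i`), `const`;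
  exponent bookkeeping `zipAdd` (product), `decrAt` (derivative), `unitVec` (variables) with
  `mexp_zipAdd`, `mexp_decrAt`, `mexp_unitVec`.
* the **natural interval extension in monomial form** over a box of rational intervals
  `B : Fin n → NonemptyInterval ℚ`: `monoEncl B m = ∏ᵢ Bᵢ^{mᵢ}` (Moore powers and products of
  `IntervalEnclosure.lean`), `encl B q = ∑ [c, c] · monoEncl B m`, `enclVec`, with the inclusion
  property `QMvPoly.eval_toMv_mem_encl` (Moore 1979 §3.3 Corollary 3.1): if `xᵢ ∈ Bᵢ` (as real
  numbers, or in any linear ordered field `K`, via `NonemptyInterval.ratCast`) then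
  `q(x) ∈ encl B q`; and inclusion monotonicity `encl_mono` (Moore 1979 §3.2 (3.4)–(3.5)).

Everything here is structurally recursive and computable; no analysis, no facts, no axioms.
Completeness / canonical forms are irrelevant for soundness (a term list is *some*
representation of its polynomial; `normalize` only keeps the lists short).  Deliberately NOT
here: outward rounding (see `NonemptyInterval.roundOut`), non-polynomial expressions
(`ArithExpr` of `Certificate.lean`), and the ODE layer (`HighOrderEnclosureCertificate.lean`).

## References

* R. E. Moore, *Methods and Applications of Interval Analysis*, SIAM 1979: §2.2 (interval
  arithmetic), §3.2 (3.4)–(3.5) (inclusion monotonicity), §3.3 Theorem 3.1 and Corollary 3.1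
  (natural interval extensions of rational functions contain the range), §3.4 (3.13)–(3.18)
  (recursive generation of Taylor coefficients by polynomial arithmetic).
  [held: lit key book:moorend-methods-applications-interval-analysis, pp. 21–27]
* R. E. Moore, *Interval Analysis*, Prentice-Hall 1966, §2.2 (the Moore product), §4.4
  (machine computation with rational intervals: the checker is exact arithmetic).
* E. Hairer, C. Lubich, G. Wanner, *Geometric Numerical Integration*, Springer 2002,
  §III.5.1 eq. (5.2) (the Lie derivative `∑ᵢ pᵢ ∂ᵢ` of a polynomial vector field, whose
  ingredients — products and partial derivatives of polynomials — are the operations here).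
-/

open NonemptyInterval

namespace Literature.Analysis.ValidatedNumerics

/-- A **sparse polynomial with rational coefficients** in the variables `x₀, x₁, …`: a list of
terms `(m, c)` standing for `c · ∏ᵢ xᵢ ^ mᵢ`, the exponent vector `m` being a list of natural
numbers (entry `i` is the exponent of `xᵢ`; missing entries are `0`).  Duplicated exponent
vectors are allowed and add up.  This is the finitely represented "polynomial in monomial form"
on which Moore's recursions operate (Moore 1979 §3.3–§3.4).
[cite: Moore1979, §3.3 (rational interval functions) and §3.4 eqs. (3.13)–(3.18)] -/
abbrev QMvPoly : Type := List (List ℕ × ℚ)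

namespace QMvPoly

/-! ### Exponent vectors as lists -/

section Exponents

variable {n : ℕ}

/-- The exponent (a finitely supported function on `Fin n`) represented by an exponent list:
`(mexp n m) i = m[i]` with default `0`. [cite: Moore1979, §3.3 (monomial form)] -/
noncomputable def mexp (n : ℕ) (m : List ℕ) : Fin n →₀ ℕ :=
  Finsupp.equivFunOnFinite.symm fun i => m.getD i 0

/-- `(mexp n m) i = m.getD i 0`. [cite: Moore1979, §3.3 (monomial form)] -/
@[simp] theorem mexp_apply (n : ℕ) (m : List ℕ) (i : Fin n) : mexp n m i = m.getD i 0 := by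
  simp [mexp]

/-- The empty exponent list is the zero exponent (the constant monomial).
[cite: Moore1979, §3.3 (monomial form)] -/
@[simp] theorem mexp_nil (n : ℕ) : mexp n [] = 0 := by
  ext i; simp

/-- Sum of two exponent lists (exponent of a product of monomials), padding the shorter one
with zeros. [cite: Moore1979, §3.4 eq. (3.18) (product rule)] -/
def zipAdd : List ℕ → List ℕ → List ℕ
  | [], b => b
  | a, [] => a
  | x :: a, y :: b => (x + y) :: zipAdd a b

/-- `zipAdd` adds entrywise. [cite: Moore1979, §3.4 eq. (3.18) (product rule)] -/
theorem getD_zipAdd : ∀ (a b : List ℕ) (i : ℕ), (zipAdd a b).getD i 0 = a.getD i 0 + b.getD i 0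
  | [], b, i => by simp [zipAdd]
  | x :: a, [], i => by simp [zipAdd]
  | x :: a, y :: b, 0 => by simp [zipAdd]
  | x :: a, y :: b, i + 1 => by
      simp only [zipAdd, List.getD_cons_succ]
      exact getD_zipAdd a b i

/-- `mexp n (zipAdd a b) = mexp n a + mexp n b`. [cite: Moore1979, §3.4 eq. (3.18) (product rule)] -/
theorem mexp_zipAdd (a b : List ℕ) : mexp n (zipAdd a b) = mexp n a + mexp n b := by
  ext i; rw [Finsupp.add_apply, mexp_apply, mexp_apply, mexp_apply, getD_zipAdd]

/-- Decrement the `i`-th entry of an exponent list (exponent of `∂ᵢ` of a monomial; truncated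
subtraction, no-op beyond the end of the list). [cite: HairerWannerLubich2002, §III.5.1 eq. (5.2)] -/
def decrAt : List ℕ → ℕ → List ℕ
  | [], _ => []
  | x :: a, 0 => (x - 1) :: a
  | x :: a, i + 1 => x :: decrAt a i

/-- Entries of `decrAt a i`. [cite: HairerWannerLubich2002, §III.5.1 eq. (5.2)] -/
theorem getD_decrAt : ∀ (a : List ℕ) (i j : ℕ),
    (decrAt a i).getD j 0 = if j = i then a.getD j 0 - 1 else a.getD j 0
  | [], i, j => by simp [decrAt]
  | x :: a, 0, 0 => by simp [decrAt]
  | x :: a, 0, j + 1 => by simp [decrAt]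
  | x :: a, i + 1, 0 => by simp [decrAt]
  | x :: a, i + 1, j + 1 => by
      simp only [decrAt, List.getD_cons_succ, getD_decrAt a i j, Nat.succ_inj]

/-- `mexp n (decrAt a i) = mexp n a - single i 1` (the exponent appearing in
`MvPolynomial.pderiv_monomial`). [cite: HairerWannerLubich2002, §III.5.1 eq. (5.2)] -/
theorem mexp_decrAt (a : List ℕ) (i : Fin n) :
    mexp n (decrAt a i) = mexp n a - Finsupp.single i 1 := by
  ext j
  simp only [mexp_apply, getD_decrAt, Finsupp.coe_tsub, Pi.sub_apply, Finsupp.single_apply]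
  by_cases h : j = i
  · subst h; simp
  · have h' : (j : ℕ) ≠ (i : ℕ) := fun e => h (Fin.ext e)
    simp [h', Ne.symm h]

/-- The exponent list of the variable `xᵢ` among `x₀, …, x_{n-1}`: `1` at position `i`, `0`
elsewhere, length `n`. [cite: Moore1979, §3.4 eq. (3.13)] -/
def unitVec : ℕ → ℕ → List ℕ
  | 0, _ => []
  | n + 1, 0 => 1 :: List.replicate n 0
  | n + 1, i + 1 => 0 :: unitVec n i

/-- Entries of a list of zeros. [cite: Moore1979, §3.4 eq. (3.13)] -/
theorem getD_replicate_zero (k j : ℕ) : (List.replicate k 0).getD j 0 = 0 := by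
  induction k generalizing j with
  | zero => simp
  | succ k ih =>
      cases j with
      | zero => simp only [List.replicate_succ, List.getD_cons_zero]
      | succ j => simp only [List.replicate_succ, List.getD_cons_succ, ih]

/-- Entries of `unitVec n i` for `i < n`. [cite: Moore1979, §3.4 eq. (3.13)] -/
theorem getD_unitVec : ∀ (n i j : ℕ), i < n →
    (unitVec n i).getD j 0 = if j = i then 1 else 0
  | 0, i, j, h => absurd h (Nat.not_lt_zero i)
  | n + 1, 0, 0, _ => by simp [unitVec]
  | n + 1, 0, j + 1, _ => by
      simp only [unitVec, List.getD_cons_succ, getD_replicate_zero]; simp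
  | n + 1, i + 1, 0, _ => by simp [unitVec]
  | n + 1, i + 1, j + 1, h => by
      simp only [unitVec, List.getD_cons_succ, getD_unitVec n i j (Nat.lt_of_succ_lt_succ h),
        Nat.succ_inj]

/-- `mexp n (unitVec n i) = single i 1`, the exponent of `Xᵢ`. [cite: Moore1979, §3.4 eq. (3.13)] -/
theorem mexp_unitVec (i : Fin n) : mexp n (unitVec n i) = Finsupp.single i 1 := by
  ext j
  simp only [mexp_apply, getD_unitVec n i j i.isLt, Finsupp.single_apply]
  by_cases h : j = i
  · subst h; simp
  · have h' : (j : ℕ) ≠ (i : ℕ) := fun e => h (Fin.ext e)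
    simp [h', Ne.symm h]

end Exponents

/-! ### Semantics in `MvPolynomial (Fin n) R` -/

section Semantics

variable (R : Type*) [Field R] (n : ℕ)

/-- The polynomial represented by a term list: `∑_{(m,c)} c · X^m` in `MvPolynomial (Fin n) R`
(the coefficients cast from `ℚ`). [cite: Moore1979, §3.3 (monomial form)] -/
noncomputable def toMv (q : QMvPoly) : MvPolynomial (Fin n) R :=
  (q.map fun t => MvPolynomial.monomial (mexp n t.1) (t.2 : R)).sum

/-- [cite: Moore1979, §3.3 (monomial form)] -/
@[simp] theorem toMv_nil : toMv R n [] = 0 := by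
  simp [toMv]

/-- [cite: Moore1979, §3.3 (monomial form)] -/
@[simp] theorem toMv_cons (t : List ℕ × ℚ) (q : QMvPoly) :
    toMv R n (t :: q) = MvPolynomial.monomial (mexp n t.1) (t.2 : R) + toMv R n q := by
  simp [toMv]

/-- Concatenation of term lists is addition of polynomials. [cite: Moore1979, §3.4 eq. (3.18) (sum rule)] -/
theorem toMv_append (p q : QMvPoly) : toMv R n (p ++ q) = toMv R n p + toMv R n q := by
  simp [toMv, List.map_append, List.sum_append]

/-- Value of one term: `(c · X^m)(x) = c · ∏ᵢ xᵢ ^ mᵢ`. [cite: Moore1979, §3.3 (monomial form)] -/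
theorem eval_monomial_mexp (x : Fin n → R) (m : List ℕ) (c : ℚ) :
    MvPolynomial.eval x (MvPolynomial.monomial (mexp n m) (c : R)) =
      (c : R) * ∏ i, x i ^ m.getD i 0 := by
  rw [MvPolynomial.eval_monomial, Finsupp.prod_fintype _ _ (fun i => pow_zero _)]
  simp

/-- Value of a term list, one term at a time. [cite: Moore1979, §3.3 (monomial form)] -/
theorem eval_toMv_cons (x : Fin n → R) (t : List ℕ × ℚ) (q : QMvPoly) :
    MvPolynomial.eval x (toMv R n (t :: q)) =
      (t.2 : R) * (∏ i, x i ^ t.1.getD i 0) + MvPolynomial.eval x (toMv R n q) := by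
  rw [toMv_cons, map_add, eval_monomial_mexp]

end Semantics

/-! ### Exact arithmetic on term lists -/

section Arithmetic

variable (R : Type*) [Field R] [CharZero R] (n : ℕ)

/-- The variable `xᵢ` (`i < n`) as a term list. [cite: Moore1979, §3.4 eq. (3.13)] -/
def var (n i : ℕ) : QMvPoly := [(unitVec n i, 1)]

omit [CharZero R] in
/-- `toMv (var n i) = Xᵢ`. [cite: Moore1979, §3.4 eq. (3.13)] -/
theorem toMv_var (i : Fin n) : toMv R n (var n i) = MvPolynomial.X i := by
  simp only [var, toMv_cons, toMv_nil, add_zero, mexp_unitVec, Rat.cast_one]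
  rw [← pow_one (MvPolynomial.X i), MvPolynomial.X_pow_eq_monomial]

/-- A rational constant as a term list. [cite: Moore1979, §3.3 (monomial form)] -/
def const (c : ℚ) : QMvPoly := [([], c)]

omit [CharZero R] in
/-- `toMv (const c) = C c`. [cite: Moore1979, §3.3 (monomial form)] -/
theorem toMv_const (c : ℚ) : toMv R n (const c) = MvPolynomial.C (c : R) := by
  simp only [const, toMv_cons, toMv_nil, add_zero, mexp_nil]
  exact MvPolynomial.C_apply.symm

/-- Scalar multiple of a term list. [cite: Moore1979, §3.4 eq. (3.18) (constant factor)] -/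
def smul (c : ℚ) (p : QMvPoly) : QMvPoly := p.map fun t => (t.1, c * t.2)

/-- `toMv (smul c p) = c • toMv p`. [cite: Moore1979, §3.4 eq. (3.18) (constant factor)] -/
theorem toMv_smul (c : ℚ) (p : QMvPoly) : toMv R n (smul c p) = (c : R) • toMv R n p := by
  induction p with
  | nil => simp [smul]
  | cons t p ih =>
      simp only [smul, List.map_cons] at ih ⊢
      rw [toMv_cons, toMv_cons, ih, smul_add, MvPolynomial.smul_monomial, smul_eq_mul,
        Rat.cast_mul]

/-- Product of the monomial `c · X^m` with a term list. [cite: Moore1979, §3.4 eq. (3.18) (product rule)] -/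
def mulMono (m : List ℕ) (c : ℚ) (p : QMvPoly) : QMvPoly :=
  p.map fun t => (zipAdd m t.1, c * t.2)

/-- `toMv (mulMono m c p) = (c · X^m) * toMv p`. [cite: Moore1979, §3.4 eq. (3.18) (product rule)] -/
theorem toMv_mulMono (m : List ℕ) (c : ℚ) (p : QMvPoly) :
    toMv R n (mulMono m c p) = MvPolynomial.monomial (mexp n m) (c : R) * toMv R n p := by
  induction p with
  | nil => simp [mulMono]
  | cons t p ih =>
      simp only [mulMono, List.map_cons] at ih ⊢
      rw [toMv_cons, toMv_cons, ih, mul_add, MvPolynomial.monomial_mul, mexp_zipAdd,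
        Rat.cast_mul]

/-- Product of two term lists (distribute term by term). [cite: Moore1979, §3.4 eq. (3.18) (product rule)] -/
def mul : QMvPoly → QMvPoly → QMvPoly
  | [], _ => []
  | t :: p, q => mulMono t.1 t.2 q ++ mul p q

/-- `toMv (mul p q) = toMv p * toMv q`. [cite: Moore1979, §3.4 eq. (3.18) (product rule)] -/
theorem toMv_mul (p q : QMvPoly) : toMv R n (mul p q) = toMv R n p * toMv R n q := by
  induction p with
  | nil => simp [mul]
  | cons t p ih => rw [mul, toMv_append, toMv_mulMono, ih, toMv_cons, add_mul]

/-- Insert one term into a term list, merging it with a term of the same exponent vector and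
dropping a resulting zero coefficient (exact rational arithmetic). [cite: Moore1966, §4.4] -/
def ins (t : List ℕ × ℚ) : QMvPoly → QMvPoly
  | [] => if t.2 = 0 then [] else [t]
  | u :: r =>
      if t.1 = u.1 then (if t.2 + u.2 = 0 then r else (u.1, t.2 + u.2) :: r) else u :: ins t r

/-- `ins` is addition of the term. [cite: Moore1966, §4.4] -/
theorem toMv_ins (t : List ℕ × ℚ) (q : QMvPoly) :
    toMv R n (ins t q) = MvPolynomial.monomial (mexp n t.1) (t.2 : R) + toMv R n q := by
  induction q with
  | nil =>
      unfold ins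
      split_ifs with h
      · simp [h]
      · simp
  | cons u r ih =>
      unfold ins
      split_ifs with h1 h2
      · rw [toMv_cons, h1, ← add_assoc, ← map_add, ← Rat.cast_add, h2, Rat.cast_zero,
          MvPolynomial.monomial_zero, zero_add]
      · rw [toMv_cons, toMv_cons, h1, ← add_assoc, ← map_add, ← Rat.cast_add]
      · rw [toMv_cons, toMv_cons, ih, add_left_comm]

/-- Merge like terms and drop zero coefficients. [cite: Moore1966, §4.4] -/
def normalize (p : QMvPoly) : QMvPoly := p.foldr ins []

/-- `normalize` does not change the polynomial. [cite: Moore1966, §4.4] -/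
theorem toMv_normalize (p : QMvPoly) : toMv R n (normalize p) = toMv R n p := by
  induction p with
  | nil => simp [normalize]
  | cons t p ih =>
      simp only [normalize, List.foldr_cons] at ih ⊢
      rw [toMv_ins, ih, toMv_cons]

/-- Formal partial derivative `∂/∂xᵢ` of a term list: `c · X^m ↦ (c mᵢ) · X^{m - eᵢ}`.
[cite: HairerWannerLubich2002, §III.5.1 eq. (5.2)] -/
def pderivQ (i : ℕ) (p : QMvPoly) : QMvPoly :=
  p.map fun t => (decrAt t.1 i, t.2 * (t.1.getD i 0 : ℕ))

/-- `toMv (pderivQ i p) = ∂ᵢ (toMv p)` (`MvPolynomial.pderiv`).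
[cite: HairerWannerLubich2002, §III.5.1 eq. (5.2)] -/
theorem toMv_pderivQ (i : Fin n) (p : QMvPoly) :
    toMv R n (pderivQ i p) = MvPolynomial.pderiv i (toMv R n p) := by
  induction p with
  | nil => simp [pderivQ]
  | cons t p ih =>
      simp only [pderivQ, List.map_cons] at ih ⊢
      rw [toMv_cons, toMv_cons, ih, map_add, MvPolynomial.pderiv_monomial, mexp_decrAt,
        mexp_apply, Rat.cast_mul, Rat.cast_natCast]

omit [CharZero R] in
/-- `toMv` of a concatenation of term lists is the sum. [cite: Moore1979, §3.4 eq. (3.18) (sum rule)] -/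
theorem toMv_flatten (L : List QMvPoly) : toMv R n L.flatten = (L.map (toMv R n)).sum := by
  induction L with
  | nil => simp
  | cons l L ih => rw [List.flatten_cons, toMv_append, ih, List.map_cons, List.sum_cons]

end Arithmetic

/-! ### Natural interval extension over a rational box -/

section Enclosure

variable {n : ℕ}

/-- Interval product over a list of indices: `∏_{i ∈ l} Fᵢ` with the Moore product, starting
from `[1, 1]`. [cite: Moore1979, §2.2 (interval arithmetic operations)] -/
def iprodList (l : List (Fin n)) (F : Fin n → NonemptyInterval ℚ) : NonemptyInterval ℚ :=
  (l.map F).foldr mooreMul (pure 1)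

/-- The natural interval extension of the monomial `∏ᵢ xᵢ ^ mᵢ` over the box `B`:
`∏ᵢ Bᵢ ^ mᵢ` with Moore powers and products. [cite: Moore1979, §3.3 Corollary 3.1] -/
def monoEncl (B : Fin n → NonemptyInterval ℚ) (m : List ℕ) : NonemptyInterval ℚ :=
  iprodList (List.finRange n) fun i => (B i).moorePow (m.getD i 0)

/-- The natural interval extension of a term list over the box `B`, in monomial form:
`∑_{(m,c)} [c, c] · ∏ᵢ Bᵢ ^ mᵢ`. [cite: Moore1979, §3.3 Corollary 3.1] -/
def encl (B : Fin n → NonemptyInterval ℚ) (p : QMvPoly) : NonemptyInterval ℚ :=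
  (p.map fun t => (pure t.2).mooreMul (monoEncl B t.1)).sum

/-- Componentwise natural interval extension of a vector of term lists.
[cite: Moore1979, §3.3 Corollary 3.1] -/
def enclVec (B : Fin n → NonemptyInterval ℚ) (P : Fin n → QMvPoly) : Fin n → NonemptyInterval ℚ :=
  fun i => encl B (P i)

variable {K : Type*} [Field K] [LinearOrder K] [IsStrictOrderedRing K]

/-- Casting rational intervals commutes with exact interval addition. [cite: Moore1966, Ch. 2] -/
theorem ratCast_add (I J : NonemptyInterval ℚ) :
    (I + J).ratCast K = I.ratCast K + J.ratCast K := by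
  apply NonemptyInterval.ext
  rw [Prod.ext_iff]
  exact ⟨by simp, by simp⟩

/-- Casting the zero interval `[0, 0]`. [cite: Moore1966, Ch. 2] -/
theorem ratCast_zero : (0 : NonemptyInterval ℚ).ratCast K = 0 := by
  apply NonemptyInterval.ext
  rw [Prod.ext_iff]
  exact ⟨by simp, by simp⟩

/-- Inclusion property of exact interval addition in a linear ordered field (Moore 1979 §2.2).
[cite: Moore1979, §2.2] -/
theorem add_mem_add_of_mem {I J : NonemptyInterval K} {a b : K} (ha : a ∈ I) (hb : b ∈ J) :
    a + b ∈ I + J := by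
  rw [NonemptyInterval.mem_def] at ha hb ⊢
  rw [NonemptyInterval.fst_add, NonemptyInterval.snd_add]
  exact ⟨add_le_add ha.1 hb.1, add_le_add ha.2 hb.2⟩

/-- Inclusion monotonicity of exact interval addition (Moore 1979 §3.2).
[cite: Moore1979, §3.2 eqs. (3.4)–(3.5)] -/
theorem add_le_add_iv {I J I' J' : NonemptyInterval K} (h : I ≤ J) (h' : I' ≤ J') :
    I + I' ≤ J + J' := by
  rw [NonemptyInterval.le_def] at h h' ⊢
  rw [NonemptyInterval.fst_add, NonemptyInterval.snd_add, NonemptyInterval.fst_add,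
    NonemptyInterval.snd_add]
  exact ⟨add_le_add h.1 h'.1, add_le_add h.2 h'.2⟩

/-- Inclusion property of interval list products. [cite: Moore1979, §3.3 Theorem 3.1] -/
theorem prod_mem_iprodList (l : List (Fin n)) {F : Fin n → NonemptyInterval ℚ} {a : Fin n → K}
    (h : ∀ i, a i ∈ (F i).ratCast K) : (l.map a).prod ∈ (iprodList l F).ratCast K := by
  induction l with
  | nil => simp [iprodList]
  | cons i l ih =>
      simp only [iprodList, List.map_cons, List.foldr_cons, List.prod_cons] at ih ⊢
      rw [ratCast_mooreMul]
      exact mul_mem_mooreMul (h i) ih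

/-- **The monomial enclosure contains the monomial's values** on the box.
[cite: Moore1979, §3.3 Corollary 3.1] -/
theorem prod_mem_monoEncl {B : Fin n → NonemptyInterval ℚ} {x : Fin n → K}
    (hx : ∀ i, x i ∈ (B i).ratCast K) (m : List ℕ) :
    (∏ i, x i ^ m.getD i 0) ∈ (monoEncl B m).ratCast K := by
  rw [Fin.prod_univ_def]
  refine prod_mem_iprodList (List.finRange n) (fun i => ?_)
  rw [ratCast_moorePow]
  exact pow_mem_moorePow (hx i) _

/-- **Moore's Corollary 3.1 for the natural extension in monomial form**: if `xᵢ ∈ Bᵢ` for all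
`i`, then the value of the polynomial at `x` lies in `encl B p`.
[cite: Moore1979, §3.3 Corollary 3.1] -/
theorem eval_toMv_mem_encl {B : Fin n → NonemptyInterval ℚ} {x : Fin n → K}
    (hx : ∀ i, x i ∈ (B i).ratCast K) (p : QMvPoly) :
    MvPolynomial.eval x (toMv K n p) ∈ (encl B p).ratCast K := by
  induction p with
  | nil =>
      simp only [toMv_nil, map_zero, encl, List.map_nil, List.sum_nil, ratCast_zero]
      exact NonemptyInterval.zero_mem_zero
  | cons t p ih =>
      simp only [encl, List.map_cons, List.sum_cons] at ih ⊢
      rw [eval_toMv_cons, ratCast_add, ratCast_mooreMul]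
      exact add_mem_add_of_mem
        (mul_mem_mooreMul (by rw [ratCast_pure]; exact NonemptyInterval.mem_pure_self _)
          (prod_mem_monoEncl hx t.1)) ih

/-- Vector form of `eval_toMv_mem_encl`. [cite: Moore1979, §3.3 Corollary 3.1] -/
theorem eval_toMv_mem_enclVec {B : Fin n → NonemptyInterval ℚ} {x : Fin n → K}
    (hx : ∀ i, x i ∈ (B i).ratCast K) (P : Fin n → QMvPoly) (i : Fin n) :
    MvPolynomial.eval x (toMv K n (P i)) ∈ (enclVec B P i).ratCast K :=
  eval_toMv_mem_encl hx (P i)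

/-- Inclusion monotonicity of interval list products. [cite: Moore1979, §3.2 eqs. (3.4)–(3.5)] -/
theorem iprodList_mono (l : List (Fin n)) {F G : Fin n → NonemptyInterval ℚ} (h : ∀ i, F i ≤ G i) :
    iprodList l F ≤ iprodList l G := by
  induction l with
  | nil => simp [iprodList]
  | cons i l ih =>
      simp only [iprodList, List.map_cons, List.foldr_cons] at ih ⊢
      exact mooreMul_le_mooreMul (h i) ih

/-- Inclusion monotonicity of Moore powers (rational intervals).
[cite: Moore1979, §3.2 eqs. (3.4)–(3.5)] -/
theorem moorePow_mono {I J : NonemptyInterval ℚ} (h : I ≤ J) (k : ℕ) :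
    I.moorePow k ≤ J.moorePow k := by
  induction k with
  | zero => simp [moorePow_zero]
  | succ k ih => rw [moorePow_succ, moorePow_succ]; exact mooreMul_le_mooreMul ih h

/-- **Inclusion monotonicity of the natural extension** (Moore 1979 §3.2): enlarging the box
enlarges the enclosure; in particular an outward-rounded box may replace an exact one.
[cite: Moore1979, §3.2 eqs. (3.4)–(3.5)] -/
theorem encl_mono {B B' : Fin n → NonemptyInterval ℚ} (h : ∀ i, B i ≤ B' i) (p : QMvPoly) :
    encl B p ≤ encl B' p := by
  induction p with
  | nil => simp [encl]
  | cons t p ih =>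
      simp only [encl, List.map_cons, List.sum_cons] at ih ⊢
      have hm : monoEncl B t.1 ≤ monoEncl B' t.1 :=
        iprodList_mono _ fun i => moorePow_mono (h i) _
      have h1 := mooreMul_le_mooreMul (le_refl (pure t.2)) hm
      exact add_le_add_iv h1 ih

end Enclosure

end QMvPoly

end Literature.Analysis.ValidatedNumerics
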